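import Mathlib
import Summits.Ventures.PercRepro2.BasePendant
import Summits.Ventures.PercRepro2.A3PendantFreeLeaf

/-!
# A pinned pendant leaf is invisible to the exploration of its attachment vertex — the fibres
(blind cell PercRepro2, night-1 g32; proofs/NIGHT1-G32.md §3; the sums are A3LeafGlue.lean)

Let `a₃` be a leaf attached to `v` by the edge `f`.  Re-route `f` to a loop at `a₃` (`glueLoop`): the
connections among the vertices other than `a₃` are the same on both graphs (`conn_glue_iff`), `a₃` is
isolated on the re-routed graph (`not_conn_glue_leaf`), and with `f` open the cluster of `v` is the
re-routed cluster with `a₃` inserted (`cluster_glue_insert`).  Hence, when `p f = 1` (`f` open a.s.),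
the `v`-fibre at `insert a₃ W` has the masses of the re-routed `v`-fibre at `W` (`mW_glue_insert`,
`Ssig_glue_insert`, `Su_glue_insert`), the `v`-fibres at sets not containing `a₃` are null
(`mW_eq_zero_of_notMem_glue`), the re-routed fibres at sets containing `a₃` are null
(`mW_glue_eq_zero_of_mem`), and `P(Q)`, `P(Q, r ↔ x)`, `P(PD_v)`, `P(PD_v, r ↔ x)` agree.
Standard axioms.
-/

namespace Summit.Ventures.PercRepro2

open UnionCluster CovForm

namespace CovForm

namespace A3Fibre

/-! ## Re-routing the leaf edge to a loop at the leaf -/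

section Reroute

variable {V : Type*} {E : Type*} [DecidableEq E]

/-- The incidence map with `f` re-routed to a loop at `a₃` (so `a₃` is isolated when `f` was its only
edge). -/
def glueLoop (ends : E → Sym2 V) (f : E) (a₃ : V) : E → Sym2 V :=
  Function.update ends f s(a₃, a₃)

/-- The re-routed edge. -/
lemma glueLoop_self (ends : E → Sym2 V) (f : E) (a₃ : V) : glueLoop ends f a₃ f = s(a₃, a₃) := by
  simp [glueLoop]

/-- The other edges are unchanged. -/
lemma glueLoop_of_ne (ends : E → Sym2 V) (f : E) (a₃ : V) {e : E} (he : e ≠ f) :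
    glueLoop ends f a₃ e = ends e := by
  simp [glueLoop, Function.update_of_ne he]

variable {ends : E → Sym2 V} {f : E} {a₃ v : V}

omit [DecidableEq E] in
/-- The leaf edge, read from `v`. -/
lemma ends_leaf_symm (hf : ends f = s(a₃, v)) : ends f = s(v, a₃) := by
  rw [hf, Sym2.eq_swap]

/-- An open adjacency of the re-routed graph is an open adjacency of the original graph (the loop is not
an adjacency of a simple graph). -/
lemma openGraph_glue_adj {ω : Config E} {y z : V}
    (h : (openGraph (glueLoop ends f a₃) ω).Adj y z) : (openGraph ends ω).Adj y z := by
  obtain ⟨hne, e, he, hends⟩ := openGraph_adj.1 h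
  by_cases hef : e = f
  · subst hef
    rw [glueLoop_self, Sym2.eq_iff] at hends
    exfalso
    rcases hends with ⟨h1, h2⟩ | ⟨h1, h2⟩
    · exact hne (h1.symm.trans h2)
    · exact hne (h2.symm.trans h1)
  · rw [glueLoop_of_ne ends f a₃ hef] at hends
    exact openGraph_adj.2 ⟨hne, e, he, hends⟩

/-- Connections of the re-routed graph are connections of the original graph. -/
lemma conn_of_conn_glue {ω : Config E} {x y : V} (h : Conn (glueLoop ends f a₃) ω x y) :
    Conn ends ω x y := by
  have hS : ∀ y' ∈ {z | Conn ends ω x z}, ∀ z, (openGraph (glueLoop ends f a₃) ω).Adj y' z →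
      z ∈ {z | Conn ends ω x z} := by
    intro y' hy' z hyz
    exact conn_trans hy' (SimpleGraph.Adj.reachable (openGraph_glue_adj hyz))
  exact mem_of_conn_of_closed hS (conn_refl ends ω x) h

/-- In the re-routed graph nothing but `a₃` itself reaches `a₃` (when `f` was its only edge). -/
lemma not_conn_glue_leaf (hleaf : ∀ e, a₃ ∈ ends e → e = f) {ω : Config E} {x : V} (hx : x ≠ a₃) :
    ¬ Conn (glueLoop ends f a₃) ω x a₃ := by
  intro h
  have hS : ∀ y' ∈ {z | z ≠ a₃}, ∀ z, (openGraph (glueLoop ends f a₃) ω).Adj y' z →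
      z ∈ {z | z ≠ a₃} := by
    intro y' hy' z hyz
    obtain ⟨hne, e, _, hends⟩ := openGraph_adj.1 hyz
    by_cases hef : e = f
    · subst hef
      rw [glueLoop_self, Sym2.eq_iff] at hends
      rcases hends with ⟨h1, h2⟩ | ⟨h1, h2⟩
      · exact absurd (h1.symm.trans h2) hne
      · exact absurd (h2.symm.trans h1) hne
    · rw [glueLoop_of_ne ends f a₃ hef] at hends
      intro hz
      apply hef
      apply hleaf e
      rw [hends, hz]
      exact Sym2.mem_mk_right _ _
  exact (mem_of_conn_of_closed hS hx h) rfl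

/-- Connections among the vertices other than `a₃` transfer to the re-routed graph. -/
lemma conn_glue_of_conn (hf : ends f = s(a₃, v)) (hleaf : ∀ e, a₃ ∈ ends e → e = f) (h3v : a₃ ≠ v)
    {ω : Config E} {x y : V} (hx : x ≠ a₃) (hy : y ≠ a₃) (h : Conn ends ω x y) :
    Conn (glueLoop ends f a₃) ω x y := by
  let S : Set V := {z | (z ≠ a₃ ∧ Conn (glueLoop ends f a₃) ω x z) ∨
    (z = a₃ ∧ Conn (glueLoop ends f a₃) ω x v)}
  have hS : ∀ y' ∈ S, ∀ z, (openGraph ends ω).Adj y' z → z ∈ S := by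
    intro y' hy' z hyz
    obtain ⟨hne, e, he, hends⟩ := openGraph_adj.1 hyz
    by_cases hy3 : y' = a₃
    · subst hy3
      obtain ⟨_, rfl⟩ := openAdj_leaf hf hleaf h3v ⟨e, he, hends⟩
      rcases hy' with ⟨h1, _⟩ | ⟨_, h2⟩
      · exact absurd rfl h1
      · exact Or.inl ⟨Ne.symm h3v, h2⟩
    · have hxy' : Conn (glueLoop ends f a₃) ω x y' := by
        rcases hy' with ⟨_, h1⟩ | ⟨h1, _⟩
        · exact h1
        · exact absurd h1 hy3
      by_cases hef : e = f
      · subst hef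
        rw [hf, Sym2.eq_iff] at hends
        rcases hends with ⟨h1, _⟩ | ⟨h1, h2⟩
        · exact absurd h1.symm hy3
        · exact Or.inr ⟨h1.symm, h2 ▸ hxy'⟩
      · have hz3 : z ≠ a₃ := by
          intro hz
          apply hef
          apply hleaf e
          rw [hends, hz]
          exact Sym2.mem_mk_right _ _
        have hadj : OpenAdj (glueLoop ends f a₃) ω y' z :=
          ⟨e, he, by rw [glueLoop_of_ne ends f a₃ hef, hends]⟩
        exact Or.inl ⟨hz3, conn_trans hxy' (conn_of_openAdj hadj)⟩
  have hmem : y ∈ S :=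
    mem_of_conn_of_closed hS (Or.inl ⟨hx, conn_refl _ ω x⟩) h
  rcases hmem with ⟨_, h1⟩ | ⟨h1, _⟩
  · exact h1
  · exact absurd h1 hy

/-- Connections among the vertices other than `a₃` are the same on both graphs. -/
lemma conn_glue_iff (hf : ends f = s(a₃, v)) (hleaf : ∀ e, a₃ ∈ ends e → e = f) (h3v : a₃ ≠ v)
    {ω : Config E} {x y : V} (hx : x ≠ a₃) (hy : y ≠ a₃) :
    Conn (glueLoop ends f a₃) ω x y ↔ Conn ends ω x y :=
  ⟨conn_of_conn_glue, conn_glue_of_conn hf hleaf h3v hx hy⟩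

/-- With `f` open, the cluster of `v` is the re-routed cluster of `v` with `a₃` inserted. -/
lemma cluster_glue_insert (hf : ends f = s(a₃, v)) (hleaf : ∀ e, a₃ ∈ ends e → e = f) (h3v : a₃ ≠ v)
    {ω : Config E} (hωf : ω f = true) :
    cluster ends ω v = insert a₃ (cluster (glueLoop ends f a₃) ω v) := by
  ext u
  simp only [mem_cluster, Set.mem_insert_iff]
  by_cases hu : u = a₃
  · subst hu
    simp only [true_or, iff_true]
    exact conn_of_openAdj ⟨f, hωf, ends_leaf_symm hf⟩
  · simp only [hu, false_or]
    exact (conn_glue_iff hf hleaf h3v (Ne.symm h3v) hu).symm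

/-- `a₃` is not in the re-routed cluster of `v`. -/
lemma notMem_cluster_glue (hleaf : ∀ e, a₃ ∈ ends e → e = f) (h3v : a₃ ≠ v) (ω : Config E) :
    a₃ ∉ cluster (glueLoop ends f a₃) ω v :=
  not_conn_glue_leaf hleaf (Ne.symm h3v)

omit [DecidableEq E] in
/-- Inserting an element absent from both sides is injective. -/
lemma insert_eq_insert_iff_of_notMem {s t : Set V} {a : V} (hs : a ∉ s) (ht : a ∉ t) :
    insert a s = insert a t ↔ s = t := by
  constructor
  · intro h
    ext u
    by_cases hu : u = a
    · subst hu
      exact ⟨fun h' => absurd h' hs, fun h' => absurd h' ht⟩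
    · have h1 : u ∈ insert a s ↔ u ∈ insert a t := by rw [h]
      simpa [Set.mem_insert_iff, hu] using h1
  · intro h
    rw [h]

/-- The connection events among the vertices other than `a₃` are the same on both graphs. -/
lemma connEvent_glue (hf : ends f = s(a₃, v)) (hleaf : ∀ e, a₃ ∈ ends e → e = f) (h3v : a₃ ≠ v)
    {x y : V} (hx : x ≠ a₃) (hy : y ≠ a₃) :
    connEvent (glueLoop ends f a₃) x y = connEvent ends x y := by
  ext ω
  simp only [mem_connEvent]
  exact conn_glue_iff hf hleaf h3v hx hy

/-- `Q` is the same on both graphs. -/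
lemma avoidAll_glue (hf : ends f = s(a₃, v)) (hleaf : ∀ e, a₃ ∈ ends e → e = f) (h3v : a₃ ≠ v)
    {a₁ a₂ : V} (h31 : a₃ ≠ a₁) (h32 : a₃ ≠ a₂) :
    avoidAll (glueLoop ends f a₃) a₂ {a₁} = avoidAll ends a₂ {a₁} := by
  rw [avoidAll_eq_compl, avoidAll_eq_compl, connEvent_glue hf hleaf h3v (Ne.symm h32) (Ne.symm h31)]

/-- `PD_v` is the same on both graphs. -/
lemma PDEvent_glue (hf : ends f = s(a₃, v)) (hleaf : ∀ e, a₃ ∈ ends e → e = f) (h3v : a₃ ≠ v)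
    {a₁ a₂ : V} (h31 : a₃ ≠ a₁) (h32 : a₃ ≠ a₂) :
    PDEvent (glueLoop ends f a₃) a₁ a₂ v = PDEvent ends a₁ a₂ v := by
  unfold PDEvent Dtilde UnionCluster.inU
  rw [connEvent_glue hf hleaf h3v (Ne.symm h31) (Ne.symm h32),
    connEvent_glue hf hleaf h3v (Ne.symm h3v) (Ne.symm h31),
    connEvent_glue hf hleaf h3v (Ne.symm h3v) (Ne.symm h32)]

end Reroute

/-! ## The fibres of `v` with the leaf pinned open -/

section Fibres

variable {V : Type*} {E : Type*} [Fintype V] [DecidableEq V] [Fintype E] [DecidableEq E]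
  {ends : E → Sym2 V} {f : E} {a₃ v : V}

omit [Fintype V] [Fintype E] in
/-- With `f` open, the `v`-fibre at `insert a₃ W` is the re-routed `v`-fibre at `W` (`a₃ ∉ W`). -/
lemma fibre_glue_insert (hf : ends f = s(a₃, v)) (hleaf : ∀ e, a₃ ∈ ends e → e = f) (h3v : a₃ ≠ v)
    {a₁ a₂ : V} (h31 : a₃ ≠ a₁) (h32 : a₃ ≠ a₂) {W : Finset V} (hW : a₃ ∉ W) :
    fibre ends a₁ a₂ v (insert a₃ W) ∩ openEdge f = fibre (glueLoop ends f a₃) a₁ a₂ v W ∩ openEdge f := by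
  ext ω
  simp only [fibre, Set.mem_inter_iff, mem_clusterEvent, mem_openEdge, avoidAll_glue hf hleaf h3v h31 h32]
  constructor
  · rintro ⟨⟨hQ, hc⟩, hωf⟩
    refine ⟨⟨hQ, ?_⟩, hωf⟩
    rw [cluster_glue_insert hf hleaf h3v hωf, Finset.coe_insert] at hc
    exact (insert_eq_insert_iff_of_notMem (notMem_cluster_glue hleaf h3v ω)
      (fun h => hW (Finset.mem_coe.1 h))).1 hc
  · rintro ⟨⟨hQ, hc⟩, hωf⟩
    refine ⟨⟨hQ, ?_⟩, hωf⟩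
    rw [cluster_glue_insert hf hleaf h3v hωf, Finset.coe_insert, hc]

omit [Fintype V] [DecidableEq V] [Fintype E] [DecidableEq E] in
/-- With `f` open, a `v`-fibre at a set not containing `a₃` is empty. -/
lemma fibre_inter_openEdge_eq_empty_of_notMem (hf : ends f = s(a₃, v)) {a₁ a₂ : V} {W : Finset V}
    (hW : a₃ ∉ W) : fibre ends a₁ a₂ v W ∩ openEdge f = ∅ := by
  ext ω
  simp only [fibre, Set.mem_inter_iff, mem_clusterEvent, mem_openEdge, Set.mem_empty_iff_false,
    iff_false, not_and]
  rintro ⟨_, hc⟩ hωf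
  apply hW
  have h3 : a₃ ∈ cluster ends ω v := conn_of_openAdj ⟨f, hωf, ends_leaf_symm hf⟩
  rw [hc] at h3
  exact Finset.mem_coe.1 h3

omit [Fintype V] [DecidableEq V] [Fintype E] in
/-- A re-routed `v`-fibre at a set containing `a₃` is empty. -/
lemma fibre_glue_eq_empty_of_mem (hleaf : ∀ e, a₃ ∈ ends e → e = f) (h3v : a₃ ≠ v) {a₁ a₂ : V}
    {W : Finset V} (hW : a₃ ∈ W) : fibre (glueLoop ends f a₃) a₁ a₂ v W = ∅ := by
  ext ω
  simp only [fibre, Set.mem_inter_iff, mem_clusterEvent, Set.mem_empty_iff_false, iff_false, not_and]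
  intro _ hc
  apply notMem_cluster_glue hleaf h3v ω
  rw [hc]
  exact Finset.mem_coe.2 hW

variable {R : Type*} [CommRing R]

omit [Fintype V] [DecidableEq V] in
/-- An edge of weight `1` is open almost surely. -/
lemma prob_inter_openEdge_of_eq_one {p : E → R} (h1 : p f = 1) (A : Set (Config E)) :
    prob p (A ∩ openEdge f) = prob p A := by
  have hup : Function.update p f 1 = p := by
    conv_lhs => rw [← h1]
    exact Function.update_eq_self f p
  have h := prob_update_one_inter_openEdge p A f
  rwa [hup] at h

omit [Fintype V] in
/-- `m_W(v)` transfers: `m_{insert a₃ W}(v) = m_W(v)` on the re-routed graph. -/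
lemma mW_glue_insert {p : E → R} (h1 : p f = 1) (hf : ends f = s(a₃, v))
    (hleaf : ∀ e, a₃ ∈ ends e → e = f) (h3v : a₃ ≠ v) {a₁ a₂ : V} (h31 : a₃ ≠ a₁) (h32 : a₃ ≠ a₂)
    {W : Finset V} (hW : a₃ ∉ W) :
    mW p ends a₁ a₂ v (insert a₃ W) = mW p (glueLoop ends f a₃) a₁ a₂ v W := by
  unfold mW
  rw [← prob_inter_openEdge_of_eq_one h1, fibre_glue_insert hf hleaf h3v h31 h32 hW,
    prob_inter_openEdge_of_eq_one h1]

omit [Fintype V] in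
/-- The fibre–connection masses transfer. -/
lemma prob_fibre_conn_glue_insert {p : E → R} (h1 : p f = 1) (hf : ends f = s(a₃, v))
    (hleaf : ∀ e, a₃ ∈ ends e → e = f) (h3v : a₃ ≠ v) {a₁ a₂ : V} (h31 : a₃ ≠ a₁) (h32 : a₃ ≠ a₂)
    {r x : V} (hr : r ≠ a₃) (hx : x ≠ a₃) {W : Finset V} (hW : a₃ ∉ W) :
    prob p (fibre ends a₁ a₂ v (insert a₃ W) ∩ connEvent ends r x) =
      prob p (fibre (glueLoop ends f a₃) a₁ a₂ v W ∩ connEvent (glueLoop ends f a₃) r x) := by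
  rw [connEvent_glue hf hleaf h3v hr hx, ← prob_inter_openEdge_of_eq_one h1, Set.inter_right_comm,
    fibre_glue_insert hf hleaf h3v h31 h32 hW, ← Set.inter_right_comm, prob_inter_openEdge_of_eq_one h1]

omit [Fintype V] in
/-- `Ssig` transfers. -/
lemma Ssig_glue_insert {p : E → R} (h1 : p f = 1) (hf : ends f = s(a₃, v))
    (hleaf : ∀ e, a₃ ∈ ends e → e = f) (h3v : a₃ ≠ v) {a₁ a₂ : V} (h31 : a₃ ≠ a₁) (h32 : a₃ ≠ a₂)
    {x : V} (hx : x ≠ a₃) {W : Finset V} (hW : a₃ ∉ W) :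
    Ssig p ends a₁ a₂ v x (insert a₃ W) = Ssig p (glueLoop ends f a₃) a₁ a₂ v x W := by
  unfold Ssig
  rw [prob_fibre_conn_glue_insert h1 hf hleaf h3v h31 h32 (Ne.symm h31) hx hW,
    prob_fibre_conn_glue_insert h1 hf hleaf h3v h31 h32 (Ne.symm h32) hx hW]

omit [Fintype V] in
/-- `Su` transfers. -/
lemma Su_glue_insert {p : E → R} (h1 : p f = 1) (hf : ends f = s(a₃, v))
    (hleaf : ∀ e, a₃ ∈ ends e → e = f) (h3v : a₃ ≠ v) {a₁ a₂ : V} (h31 : a₃ ≠ a₁) (h32 : a₃ ≠ a₂)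
    {x : V} (hx : x ≠ a₃) {W : Finset V} (hW : a₃ ∉ W) :
    Su p ends a₁ a₂ v x (insert a₃ W) = Su p (glueLoop ends f a₃) a₁ a₂ v x W := by
  unfold Su
  rw [prob_fibre_conn_glue_insert h1 hf hleaf h3v h31 h32 (Ne.symm h31) hx hW,
    prob_fibre_conn_glue_insert h1 hf hleaf h3v h31 h32 (Ne.symm h32) hx hW]

omit [Fintype V] [DecidableEq V] in
/-- A `v`-fibre at a set not containing `a₃` is null. -/
lemma mW_eq_zero_of_notMem_glue {p : E → R} (h1 : p f = 1) (hf : ends f = s(a₃, v)) (a₁ a₂ : V)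
    {W : Finset V} (hW : a₃ ∉ W) : mW p ends a₁ a₂ v W = 0 := by
  unfold mW
  rw [← prob_inter_openEdge_of_eq_one h1, fibre_inter_openEdge_eq_empty_of_notMem hf hW, prob_empty]

omit [Fintype V] [DecidableEq V] in
/-- A re-routed `v`-fibre at a set containing `a₃` is null. -/
lemma mW_glue_eq_zero_of_mem (p : E → R) (hleaf : ∀ e, a₃ ∈ ends e → e = f) (h3v : a₃ ≠ v)
    (a₁ a₂ : V) {W : Finset V} (hW : a₃ ∈ W) : mW p (glueLoop ends f a₃) a₁ a₂ v W = 0 := by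
  unfold mW
  rw [fibre_glue_eq_empty_of_mem hleaf h3v hW, prob_empty]

omit [Fintype V] [DecidableEq V] in
/-- `P(Q)` is the same on both graphs. -/
lemma probQ_glue (p : E → R) (hf : ends f = s(a₃, v)) (hleaf : ∀ e, a₃ ∈ ends e → e = f)
    (h3v : a₃ ≠ v) {a₁ a₂ : V} (h31 : a₃ ≠ a₁) (h32 : a₃ ≠ a₂) :
    prob p (avoidAll (glueLoop ends f a₃) a₂ {a₁}) = prob p (avoidAll ends a₂ {a₁}) := by
  rw [avoidAll_glue hf hleaf h3v h31 h32]

omit [Fintype V] [DecidableEq V] in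
/-- `P(Q ∩ {r ↔ x})` is the same on both graphs. -/
lemma probQconn_glue (p : E → R) (hf : ends f = s(a₃, v)) (hleaf : ∀ e, a₃ ∈ ends e → e = f)
    (h3v : a₃ ≠ v) {a₁ a₂ : V} (h31 : a₃ ≠ a₁) (h32 : a₃ ≠ a₂) {r x : V} (hr : r ≠ a₃) (hx : x ≠ a₃) :
    prob p (avoidAll (glueLoop ends f a₃) a₂ {a₁} ∩ connEvent (glueLoop ends f a₃) r x) =
      prob p (avoidAll ends a₂ {a₁} ∩ connEvent ends r x) := by
  rw [avoidAll_glue hf hleaf h3v h31 h32, connEvent_glue hf hleaf h3v hr hx]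

omit [Fintype V] [DecidableEq V] in
/-- `P(PD_v)` is the same on both graphs. -/
lemma probPD_glue (p : E → R) (hf : ends f = s(a₃, v)) (hleaf : ∀ e, a₃ ∈ ends e → e = f)
    (h3v : a₃ ≠ v) {a₁ a₂ : V} (h31 : a₃ ≠ a₁) (h32 : a₃ ≠ a₂) :
    prob p (PDEvent (glueLoop ends f a₃) a₁ a₂ v) = prob p (PDEvent ends a₁ a₂ v) := by
  rw [PDEvent_glue hf hleaf h3v h31 h32]

omit [Fintype V] [DecidableEq V] in
/-- `P(PD_v ∩ {r ↔ x})` is the same on both graphs. -/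
lemma probPDconn_glue (p : E → R) (hf : ends f = s(a₃, v)) (hleaf : ∀ e, a₃ ∈ ends e → e = f)
    (h3v : a₃ ≠ v) {a₁ a₂ : V} (h31 : a₃ ≠ a₁) (h32 : a₃ ≠ a₂) {r x : V} (hr : r ≠ a₃) (hx : x ≠ a₃) :
    prob p (PDEvent (glueLoop ends f a₃) a₁ a₂ v ∩ connEvent (glueLoop ends f a₃) r x) =
      prob p (PDEvent ends a₁ a₂ v ∩ connEvent ends r x) := by
  rw [PDEvent_glue hf hleaf h3v h31 h32, connEvent_glue hf hleaf h3v hr hx]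

end Fibres

end A3Fibre

end CovForm

end Summit.Ventures.PercRepro2
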